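import Literature.NumberTheory.LFunctions.Zhang2022.DetectorBridgeMinimal
import Literature.NumberTheory.LFunctions.Zhang2022.DetectorDictCircle
import Literature.NumberTheory.LFunctions.Zhang2022.DetectorTwoSidedGlued
import Literature.NumberTheory.LFunctions.Zhang2022.DetectorShiftPSDSharp
import Literature.NumberTheory.LFunctions.Zhang2022.DetectorDictShiftDischarge
import Literature.NumberTheory.LFunctions.Zhang2022.DetectorShiftLatticeSymbol

/-!
# SHARPNESS of Lemma 2.3's box for the two-sided shift-detector form: the twist witness (case (A)) and the
# equivalence `DictShiftPSD b ↔ SignAdmissible b`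

Sub-cell E of the `landau-siegel` programme (ls-barrier-num g3; memo HOME/barrier/num/TWO-SIDED-CIRCLE.md §7). The circle
chain (K2″ `DetectorTwoPointIdentity`, Id-7 `DetectorDictCircle`/`DetectorDictShiftCircle`, `DetectorDictShiftDischarge`)
proves `SignAdmissible b → DictShiftPSD b`. This file proves the CONVERSE for sorted positive distinct triples with
`c₀(b) > 0`: if `b` is not sign-admissible, some integer `m₀` has `σ_b(m₀) < 0` (`signAdmissible_iff_latticeSymbol_nonneg`),
and then either (B) the doubly-clamped bulk form of a unit interval is indefinite — a one-sided compactly supported witness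
(`Det.not_formDetPSD_of_clampedNegWitness`, `DetectorShiftPSDSharp`) — or (A) it is PSD, and the TWIST PROFILE
`G(y) = −iπm₀·e^(iπm₀y)` has `DictShift b G < 0`: by [K1‴] + the two-point identity its energy is `c₀` times the circle
energy of `(e^(iπm₀·) − ω) ⊕ bridge`, the bridge is MINIMAL among equal-jet competitors (`DetectorBridgeMinimal`), the
shifted mode `ω(e^(iπm₀·) − 1)` (`ω = (−1)^m₀`) is such a competitor, and a lattice mode has constant bulk density
`π⁴σ_b(m₀)`, so `(π/2)·DictShift b G ≤ 2π⁴c₀σ_b(m₀) < 0`.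

Main results: `Det.bulkFormOn_latticeMode` (mode energy), `Det.dictShift_twist_neg` (case (A) witness),
`Det.not_dictShiftPSD_of_not_signAdmissible`, **`Det.dictShiftPSD_iff_signAdmissible`** (for `0 < b₀ < b₁ < b₂`, `c₀ > 0`).
Nothing here asserts anything about `L`-functions. 0 facts, 0 sorries.
«The programme SEARCHES and TYPES; no claim about Landau–Siegel zeros, Theorems 1–2 of arXiv:2211.02515 or a repaired
Margin232 until a kernel theorem says so.» -/

noncomputable section

open Complex Real ComplexConjugate Set MeasureTheory intervalIntegral

namespace Literature.NumberTheory.LFunctions.Zhang2022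

namespace Det

open Repair

variable (b : Fin 3 → ℝ)

/-! ### Part 1 — the lattice mode `e^(iπmy)` and its constant bulk density -/

/-- The lattice mode `F_m(y) = e^(iπmy)`. [cite: Zhang2022LandauSiegel, Prop 7.1 p.44 with (8.11)–(8.23)] -/
def latticeMode (m : ℤ) (y : ℝ) : ℂ := cexp (((π * m * y : ℝ)) * I)

/-- `F_m′ = iπm·F_m`. [cite: Zhang2022LandauSiegel, Prop 7.1 p.44] -/
def latticeModeD (m : ℤ) (y : ℝ) : ℂ := ((π * m : ℝ) : ℂ) * I * latticeMode m y

/-- `F_m″ = (iπm)²·F_m`. [cite: Zhang2022LandauSiegel, Prop 7.1 p.44] -/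
def latticeModeDD (m : ℤ) (y : ℝ) : ℂ := (((π * m : ℝ) : ℂ) * I) ^ 2 * latticeMode m y

variable (m : ℤ)

/-- `F_m` is differentiable with derivative `F_m′`. [cite: Zhang2022LandauSiegel, Prop 7.1 p.44] -/
theorem hasDerivAt_latticeMode (y : ℝ) : HasDerivAt (latticeMode m) (latticeModeD m y) y := by
  have h : HasDerivAt (fun y : ℝ => ((π * m * y : ℝ) : ℂ) * I) (((π * m : ℝ) : ℂ) * I) y := by
    have h1 : HasDerivAt (fun y : ℝ => (π * m * y : ℝ)) (π * m) y := by
      simpa using (hasDerivAt_id y).const_mul (π * m)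
    have h2 := h1.ofReal_comp.mul_const I
    simpa using h2
  refine (h.cexp).congr_deriv ?_
  simp only [latticeModeD, latticeMode]
  ring

/-- `F_m′` is differentiable with derivative `F_m″`. [cite: Zhang2022LandauSiegel, Prop 7.1 p.44] -/
theorem hasDerivAt_latticeModeD (y : ℝ) : HasDerivAt (latticeModeD m) (latticeModeDD m y) y := by
  have h := (hasDerivAt_latticeMode m y).const_mul (((π * m : ℝ) : ℂ) * I)
  have e : latticeModeD m = fun y => ((π * m : ℝ) : ℂ) * I * latticeMode m y := rfl
  rw [e]
  refine h.congr_deriv ?_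
  simp only [latticeModeDD, latticeModeD]
  ring

/-- `F_m · conj F_m = 1`. [cite: Zhang2022LandauSiegel, Prop 7.1 p.44 with (8.11)–(8.23)] -/
theorem latticeMode_mul_conj (y : ℝ) : latticeMode m y * conj (latticeMode m y) = 1 := by
  unfold latticeMode
  rw [Complex.mul_conj, Complex.normSq_eq_norm_sq, Complex.norm_exp_ofReal_mul_I]
  simp

/-- `Re F_m(y) = cos(πmy)`. [cite: Zhang2022LandauSiegel, Prop 7.1 p.44 with (8.11)–(8.23)] -/
theorem latticeMode_re (y : ℝ) : (latticeMode m y).re = Real.cos (π * m * y) := by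
  unfold latticeMode
  rw [Complex.exp_ofReal_mul_I_re]

/-- `F_m(0) = 1`. [cite: Zhang2022LandauSiegel, Prop 7.1 p.44 with (8.11)–(8.23)] -/
theorem latticeMode_zero : latticeMode m 0 = 1 := by simp [latticeMode]

/-- `F_m(1) = (−1)^m`. [cite: Zhang2022LandauSiegel, Prop 7.1 p.44 with (8.11)–(8.23)] -/
theorem latticeMode_one : latticeMode m 1 = (((-1 : ℝ) ^ m : ℝ) : ℂ) := by
  unfold latticeMode
  rw [mul_one]
  have : (((π * m : ℝ)) : ℂ) * I = (m : ℂ) * (π * I) := by push_cast; ring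
  rw [this, Complex.exp_int_mul, Complex.exp_pi_mul_I]
  push_cast
  rfl

/-- `F_m(y + 1) = (−1)^m · F_m(y)` (period-2 lattice mode). [cite: Zhang2022LandauSiegel, Prop 7.1 p.44 with (8.11)–(8.23)] -/
theorem latticeMode_add_one (y : ℝ) : latticeMode m (y + 1) = (((-1 : ℝ) ^ m : ℝ) : ℂ) * latticeMode m y := by
  rw [← latticeMode_one m]
  unfold latticeMode
  rw [← Complex.exp_add]
  congr 1
  push_cast
  ring

/-- `((−1)^m)² = 1` in `ℝ`. [folklore] -/
private theorem neg_one_zpow_sq : ((-1 : ℝ) ^ m) ^ 2 = 1 := by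
  rw [← zpow_natCast, ← zpow_mul, mul_comm, zpow_mul]
  norm_num

/-- `∫₀¹ cos(πmy) dy = 0` for a non-zero integer `m`. [folklore] -/
private theorem integral_cos_pi_int_mul (hm : m ≠ 0) : ∫ y in (0:ℝ)..1, Real.cos (π * m * y) = 0 := by
  have hπm : (π * m : ℝ) ≠ 0 := mul_ne_zero Real.pi_ne_zero (Int.cast_ne_zero.2 hm)
  have hF : ∀ y ∈ uIcc (0:ℝ) 1, HasDerivAt (fun y : ℝ => Real.sin (π * m * y) / (π * m)) (Real.cos (π * m * y)) y := by
    intro y _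
    have h1 : HasDerivAt (fun y : ℝ => π * m * y) (π * m) y := by simpa using (hasDerivAt_id y).const_mul (π * m)
    exact ((h1.sin).div_const (π * m)).congr_deriv (mul_div_cancel_right₀ _ hπm)
  rw [intervalIntegral.integral_eq_sub_of_hasDerivAt hF (by apply Continuous.intervalIntegrable; fun_prop)]
  have hsin : Real.sin (π * m) = 0 := by
    rw [mul_comm]; exact Real.sin_int_mul_pi m
  simp [hsin]

/-- Pointwise: on data `(s·F − c, s·F′, s·F″)` with real `s, c`, `s² = 1`, the bulk density is
`π⁴σ_b(m) − π⁴e₃·m·s·c·cos(πmy)`. [cite: Zhang2022LandauSiegel, Prop 7.1 p.44 with (8.11)–(8.23)] -/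
private theorem mode_density (s c : ℝ) (hs : s ^ 2 = 1) (y : ℝ) :
    ‖(s : ℂ) * latticeModeDD m y‖ ^ 2
        + π * (b 0 + b 1 + b 2) * (((s : ℂ) * latticeModeDD m y) * conj ((s : ℂ) * latticeModeD m y)).im
        + π ^ 2 * (b 0 * b 1 + b 1 * b 2 + b 2 * b 0) * ‖(s : ℂ) * latticeModeD m y‖ ^ 2
        + π ^ 3 * (b 0 * b 1 * b 2) * (((s : ℂ) * latticeModeD m y) * conj ((s : ℂ) * latticeMode m y - (c : ℂ))).im
      = π ^ 4 * latticeSymbol b m - π ^ 4 * (b 0 * b 1 * b 2) * m * s * c * Real.cos (π * m * y) := by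
  have hz := latticeMode_mul_conj m y
  have hre := latticeMode_re m y
  rw [Complex.mul_conj, Complex.normSq_apply] at hz
  set z := latticeMode m y with hzdef
  unfold latticeModeDD latticeModeD
  rw [← hzdef, latticeSymbol_eq, ← hre]
  have hz' : z.re * z.re + z.im * z.im = 1 := by
    have := congrArg Complex.re hz
    simpa using this
  rw [Complex.sq_norm, Complex.sq_norm, Complex.normSq_apply, Complex.normSq_apply]
  simp only [Complex.mul_re, Complex.mul_im, Complex.sub_re, Complex.sub_im, Complex.conj_re, Complex.conj_im,
    Complex.I_re, Complex.I_im, Complex.ofReal_re, Complex.ofReal_im, pow_two]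
  linear_combination (π ^ 4 * (m:ℝ) ^ 4 * s ^ 2 + π ^ 4 * (b 0 + b 1 + b 2) * (m:ℝ) ^ 3 * s ^ 2
      + π ^ 4 * (b 0 * b 1 + b 1 * b 2 + b 2 * b 0) * (m:ℝ) ^ 2 * s ^ 2 + π ^ 4 * (b 0 * b 1 * b 2) * (m:ℝ) * s ^ 2) * hz'
    + (π ^ 4 * (m:ℝ) ^ 4 + π ^ 4 * (b 0 + b 1 + b 2) * (m:ℝ) ^ 3
      + π ^ 4 * (b 0 * b 1 + b 1 * b 2 + b 2 * b 0) * (m:ℝ) ^ 2 + π ^ 4 * (b 0 * b 1 * b 2) * (m:ℝ)) * hs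

/-- **MODE ENERGY.** For a non-zero integer `m` and real `s, c` with `s² = 1`, the bulk form of `(s·F_m − c)` on `[0,1]` is
`π⁴·σ_b(m)`: a lattice mode has CONSTANT bulk density (the `cos` cross term integrates to zero).
[cite: Zhang2022LandauSiegel, Prop 7.1 p.44 with (7.2), (8.11)–(8.23)] -/
theorem bulkFormOn_latticeMode (hm : m ≠ 0) (s c : ℝ) (hs : s ^ 2 = 1) :
    bulkFormOn b 0 1 (fun y => (s : ℂ) * latticeMode m y - (c : ℂ)) (fun y => (s : ℂ) * latticeModeD m y)
        (fun y => (s : ℂ) * latticeModeDD m y)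
      = π ^ 4 * latticeSymbol b m := by
  unfold bulkFormOn
  rw [intervalIntegral.integral_congr (fun y _ => mode_density b m s c hs y)]
  have hcos : IntervalIntegrable (fun y : ℝ => Real.cos (π * m * y)) volume 0 1 := by
    apply Continuous.intervalIntegrable; fun_prop
  rw [intervalIntegral.integral_sub intervalIntegrable_const (hcos.const_mul _), intervalIntegral.integral_const,
    intervalIntegral.integral_const_mul, integral_cos_pi_int_mul m hm]
  simp

/-! ### Part 2 — the twist profile `G = −F_m′` and its energy identity -/

/-- The TWIST PROFILE `G_m(y) = −iπm·e^(iπmy)` (`= −F_m′`). [cite: Zhang2022LandauSiegel, §12 (12.6)–(12.8); Prop 7.1 p.44] -/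
def twistProfile (m : ℤ) (y : ℝ) : ℂ := -latticeModeD m y

/-- Its derivative companion `G_m′ = −F_m″`. [cite: Zhang2022LandauSiegel, Prop 7.1 p.44] -/
def twistProfile' (m : ℤ) (y : ℝ) : ℂ := -latticeModeDD m y

/-- The twist profile is a kinked (indeed smooth) profile. [cite: Zhang2022LandauSiegel, Prop 7.1 p.44] -/
theorem kinkedProfile_twistProfile : KinkedProfile (twistProfile m) (twistProfile' m) := by
  have hc : Continuous (twistProfile m) :=
    (continuous_iff_continuousAt.2 fun y => (hasDerivAt_latticeModeD m y).continuousAt).neg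
  have hc' : Continuous (twistProfile' m) := by
    have : Continuous (latticeModeDD m) := by
      unfold latticeModeDD
      exact continuous_const.mul (continuous_iff_continuousAt.2 fun y => (hasDerivAt_latticeMode m y).continuousAt)
    exact this.neg
  exact ⟨hc.continuousOn, fun x _ => ((hasDerivAt_latticeModeD m x).neg).hasDerivWithinAt,
    memLp_two_of_continuousOn_Icc' hc'.continuousOn⟩

/-- `∫₀¹ G_m = F_m(0) − F_m(1) = 1 − (−1)^m`. [cite: Zhang2022LandauSiegel, Prop 7.1 p.44] -/
theorem integral_twistProfile : ∫ y in (0:ℝ)..1, twistProfile m y = 1 - (((-1 : ℝ) ^ m : ℝ) : ℂ) := by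
  unfold twistProfile
  rw [intervalIntegral.integral_neg, intervalIntegral.integral_eq_sub_of_hasDerivAt
    (fun y _ => hasDerivAt_latticeMode m y) ((continuous_iff_continuousAt.2 fun y =>
      (hasDerivAt_latticeModeD m y).continuousAt).intervalIntegrable 0 1), latticeMode_one, latticeMode_zero]
  ring

/-- `tailPrim G_m = F_m − (−1)^m` on `[0,1]`. [cite: Zhang2022LandauSiegel, Prop 7.1 p.44] -/
theorem tailPrim_twistProfile (y : ℝ) : tailPrim (twistProfile m) y = latticeMode m y - (((-1 : ℝ) ^ m : ℝ) : ℂ) := by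
  unfold tailPrim twistProfile
  rw [intervalIntegral.integral_neg, intervalIntegral.integral_eq_sub_of_hasDerivAt
    (fun t _ => hasDerivAt_latticeMode m t) ((continuous_iff_continuousAt.2 fun t =>
      (hasDerivAt_latticeModeD m t).continuousAt).intervalIntegrable y 1), latticeMode_one]
  ring

/-- The right arc of the twist profile has energy `π⁴σ_b(m)`. [cite: Zhang2022LandauSiegel, Prop 7.1 p.44 with (8.11)–(8.23)] -/
theorem bulkFormOn_tailPrim_twistProfile (hm : m ≠ 0) :
    bulkFormOn b 0 1 (tailPrim (twistProfile m)) (fun y => -twistProfile m y) (fun y => -twistProfile' m y)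
      = π ^ 4 * latticeSymbol b m := by
  rw [← bulkFormOn_latticeMode b m hm 1 ((-1 : ℝ) ^ m) (by norm_num)]
  unfold bulkFormOn
  refine intervalIntegral.integral_congr fun y _ => ?_
  simp only [tailPrim_twistProfile, twistProfile, twistProfile', neg_neg, Complex.ofReal_one, one_mul]

/-- **The doubly-clamped bulk form of the unit interval is PSD on `C²` data** — the hypothesis of case (A) of the sharpness
dichotomy (its failure is case (B), `Det.not_formDetPSD_of_clampedNegWitness`). [cite: Zhang2022LandauSiegel, Prop 7.1 p.44 with (7.2)] -/
def ClampedBulkNonneg (b : Fin 3 → ℝ) : Prop :=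
  ∀ φ φ' φ'' : ℝ → ℂ, (∀ t ∈ uIcc (0:ℝ) 1, HasDerivAt φ (φ' t) t) → (∀ t ∈ uIcc (0:ℝ) 1, HasDerivAt φ' (φ'' t) t) →
    ContinuousOn φ'' (Icc 0 1) → φ 0 = 0 → φ 1 = 0 → φ' 0 = 0 → φ' 1 = 0 → 0 ≤ bulkFormOn b 0 1 φ φ' φ''

variable {b m}

/-- **CASE (A) WITNESS.** For a triple with distinct non-zero entries and `c₀(b) > 0`, a non-zero integer `m` with
`σ_b(m) < 0`, and the doubly-clamped form PSD, the twist profile has a NEGATIVE two-sided form: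
`(π/2)·DictShift b G_m ≤ 2π⁴c₀σ_b(m) < 0`. [cite: Zhang2022LandauSiegel, §2 Lemma 2.3; Prop 7.1 p.44 with (7.2), (8.11)–(8.23); §18 (18.1)] -/
theorem dictShift_twist_neg (h01 : b 0 ≠ b 1) (h02 : b 0 ≠ b 2) (h12 : b 1 ≠ b 2) (hb0 : ∀ j, b j ≠ 0)
    (hc : 0 < (∑ j : Fin 3, shiftW b j).re) (hm : m ≠ 0) (hσ : latticeSymbol b m < 0)
    (hQ : ClampedBulkNonneg b) :
    DictShift b (twistProfile m) (twistProfile' m) < 0 := by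
  set G := twistProfile m with hGdef
  set G' := twistProfile' m with hG'def
  set ω : ℝ := (-1 : ℝ) ^ m with hω
  have hω2 : ω ^ 2 = 1 := neg_one_zpow_sq m
  have hG : KinkedProfile G G' := kinkedProfile_twistProfile m
  -- data of G
  have hI : (∫ y in (0:ℝ)..1, G y) = 1 - (ω : ℂ) := integral_twistProfile m
  have hG0 : G 0 = -(((π * m : ℝ) : ℂ) * I) := by
    simp [hGdef, twistProfile, latticeModeD, latticeMode_zero]
  have hG1 : G 1 = -(((π * m : ℝ) : ℂ) * I * (ω : ℂ)) := by
    simp [hGdef, twistProfile, latticeModeD, latticeMode_one, hω]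
  -- [K1‴]
  have hK1 := dictShift_eq_bulk_add_twoPoint hb0 hG
  -- the two-point bridge with the jets of `tailPrim G`
  set p₁ : ℂ := ∫ y in (0:ℝ)..1, G y
  set q₁ : ℂ := -G 0
  set q₂ : ℂ := -conj (G 1)
  have hc' : (atomA0 b).re ≠ 0 := hc.ne'
  have hTP := twoPointIdentity_of_re_ne_zero b p₁ q₁ 0 q₂ h01 h02 h12 hc'
  obtain ⟨hE0, hE0', hE1, hE1'⟩ := twoPointExt_boundary_of_re_ne_zero b p₁ q₁ 0 q₂ h01 h02 h12 hc'
  set γ := twoPointCoeff b p₁ q₁ 0 q₂ with hγ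
  rw [twoPointGlue_eq_F0DetC (hb0 0) (hb0 1) (hb0 2)] at hTP
  have hfe0 : freeEndForm b 0 q₂ = freeEndForm b 0 (-conj (G 1)) := rfl
  have key : π / 2 * DictShift b G G' = (atomA0 b).re *
      (bulkFormOn b 0 1 (tailPrim G) (fun y => -G y) (fun y => -G' y)
        + bulkFormOn b 0 1 (extremal b γ) (extremalD b γ) (extremalDD b γ)) := by
    have e1 : (∑ j : Fin 3, shiftW b j).re = (atomA0 b).re := rfl
    rw [e1] at hK1
    simp only [neg_neg, q₁, q₂, p₁] at hTP
    linear_combination hK1 - hTP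
  -- the right arc: mode energy
  have hR : bulkFormOn b 0 1 (tailPrim G) (fun y => -G y) (fun y => -G' y) = π ^ 4 * latticeSymbol b m :=
    bulkFormOn_tailPrim_twistProfile b m hm
  -- the competitor ψ = ω(F − 1) and the clamped difference φ = ψ − E
  set ψ : ℝ → ℂ := fun y => (ω : ℂ) * latticeMode m y - (ω : ℂ) with hψ
  set ψ' : ℝ → ℂ := fun y => (ω : ℂ) * latticeModeD m y with hψ'
  set ψ'' : ℝ → ℂ := fun y => (ω : ℂ) * latticeModeDD m y with hψ''
  have hψE : bulkFormOn b 0 1 ψ ψ' ψ'' = π ^ 4 * latticeSymbol b m := bulkFormOn_latticeMode b m hm ω ω hω2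
  set φ : ℝ → ℂ := fun y => ψ y - extremal b γ y with hφ
  set φ' : ℝ → ℂ := fun y => ψ' y - extremalD b γ y with hφ'
  set φ'' : ℝ → ℂ := fun y => ψ'' y - extremalDD b γ y with hφ''
  have dψ : ∀ t, HasDerivAt ψ (ψ' t) t := fun t => by
    have := ((hasDerivAt_latticeMode m t).const_mul (ω : ℂ)).sub_const (ω : ℂ)
    simpa [hψ, hψ'] using this
  have dψ' : ∀ t, HasDerivAt ψ' (ψ'' t) t := fun t => by
    have := (hasDerivAt_latticeModeD m t).const_mul (ω : ℂ)
    simpa [hψ', hψ''] using this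
  have dφ : ∀ t ∈ uIcc (0:ℝ) 1, HasDerivAt φ (φ' t) t := fun t _ => (dψ t).sub (hasDerivAt_extremal b γ t)
  have dφ' : ∀ t ∈ uIcc (0:ℝ) 1, HasDerivAt φ' (φ'' t) t := fun t _ => (dψ' t).sub (hasDerivAt_extremalD b γ t)
  have cφ'' : ContinuousOn φ'' (Icc 0 1) := by
    have c1 : Continuous (latticeModeDD m) := by
      unfold latticeModeDD
      exact continuous_const.mul (continuous_iff_continuousAt.2 fun y => (hasDerivAt_latticeMode m y).continuousAt)
    exact ((continuous_const.mul c1).sub (continuous_extremalDD b γ)).continuousOn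
  -- the four clamps of φ
  have hω' : ((ω : ℝ) : ℂ) * (ω : ℂ) = 1 := by
    rw [← Complex.ofReal_mul, ← sq, hω2]; simp
  have f0 : φ 0 = 0 := by
    simp only [hφ, hψ, latticeMode_zero, hE0, map_zero]; ring
  have f1 : φ 1 = 0 := by
    simp only [hφ, hψ, latticeMode_one, hE1, p₁, hI, ← hω]
    linear_combination hω'
  have f0' : φ' 0 = 0 := by
    simp only [hφ', hψ', latticeModeD, latticeMode_zero, hE0', q₂, hG1, map_neg, map_mul, Complex.conj_ofReal,
      Complex.conj_I]
    ring
  have f1' : φ' 1 = 0 := by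
    simp only [hφ', hψ', latticeModeD, latticeMode_one, hE1', q₁, hG0, ← hω]
    linear_combination (((π * m : ℝ) : ℂ) * I) * hω'
  -- minimality: T(E) ≤ T(E + φ) = T(ψ)
  have hmin := bulkFormOn_extremal_le_of_clampedNonneg b γ dφ dφ' cφ'' f0 f1 f0' f1' (hQ φ φ' φ'' dφ dφ' cφ'' f0 f1 f0' f1')
  have hsum : bulkFormOn b 0 1 (fun y => extremal b γ y + φ y) (fun y => extremalD b γ y + φ' y)
      (fun y => extremalDD b γ y + φ'' y) = bulkFormOn b 0 1 ψ ψ' ψ'' := by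
    congr 1 <;> funext y <;> simp [hφ, hφ', hφ'']
  rw [hsum, hψE] at hmin
  -- assemble
  have hπ : 0 < π / 2 := by positivity
  have hneg : (atomA0 b).re * (bulkFormOn b 0 1 (tailPrim G) (fun y => -G y) (fun y => -G' y)
      + bulkFormOn b 0 1 (extremal b γ) (extremalD b γ) (extremalDD b γ)) < 0 := by
    have hc'' : 0 < (atomA0 b).re := hc
    have : bulkFormOn b 0 1 (tailPrim G) (fun y => -G y) (fun y => -G' y)
        + bulkFormOn b 0 1 (extremal b γ) (extremalD b γ) (extremalDD b γ) < 0 := by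
      rw [hR]; nlinarith [hmin, hσ, Real.pi_pos, pow_pos Real.pi_pos 4]
    exact mul_neg_of_pos_of_neg hc'' this
  rw [← key] at hneg
  by_contra hnn
  have : 0 ≤ DictShift b G G' := le_of_not_gt hnn
  nlinarith [mul_nonneg hπ.le this]

/-! ### Part 3 — the dichotomy and the equivalence `DictShiftPSD b ↔ SignAdmissible b` -/

/-- Case (A): `c₀ > 0`, a lattice point with `σ_b(m) < 0`, doubly-clamped form PSD ⇒ `¬ DictShiftPSD b` (twist witness).
[cite: Zhang2022LandauSiegel, §2 Lemma 2.3; Prop 7.1 p.44; §18 (18.1)] -/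
theorem not_dictShiftPSD_of_clampedBulkNonneg (h01 : b 0 ≠ b 1) (h02 : b 0 ≠ b 2) (h12 : b 1 ≠ b 2)
    (hb0 : ∀ j, b j ≠ 0) (hc : 0 < (∑ j : Fin 3, shiftW b j).re) (hm : m ≠ 0) (hσ : latticeSymbol b m < 0)
    (hQ : ClampedBulkNonneg b) : ¬ DictShiftPSD b := by
  intro h
  have h1 := h (twistProfile m) (twistProfile' m) (kinkedProfile_twistProfile m).isH1
  have h2 := dictShift_twist_neg h01 h02 h12 hb0 hc hm hσ hQ
  linarith

/-- Case (B): `c₀ > 0` and the doubly-clamped form NOT PSD ⇒ `¬ DictShiftPSD b` (one-sided compactly supported witness).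
[cite: Zhang2022LandauSiegel, §2 Lemma 2.3; Prop 7.1 p.44] -/
theorem not_dictShiftPSD_of_not_clampedBulkNonneg (hb : Function.Injective b) (hc : 0 < (∑ j : Fin 3, shiftW b j).re)
    (hQ : ¬ ClampedBulkNonneg b) : ¬ DictShiftPSD b := by
  intro h
  apply hQ
  intro φ φ' φ'' dφ dφ' cφ'' f0 f1 f0' f1'
  by_contra hneg
  have hlt : bulkFormOn b 0 1 φ φ' φ'' < 0 := lt_of_not_ge hneg
  have cφ : ContinuousOn φ (Icc 0 1) := fun t ht =>
    (dφ t (by rwa [uIcc_of_le zero_le_one])).continuousAt.continuousWithinAt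
  have cφ' : ContinuousOn φ' (Icc 0 1) := fun t ht =>
    (dφ' t (by rwa [uIcc_of_le zero_le_one])).continuousAt.continuousWithinAt
  have hno := not_formDetPSD_of_clampedNegWitness hb hc cφ cφ'
    (fun y hy => (dφ y (by rw [uIcc_of_le zero_le_one]; exact Ioo_subset_Icc_self hy)).hasDerivWithinAt)
    (fun y hy => (dφ' y (by rw [uIcc_of_le zero_le_one]; exact Ioo_subset_Icc_self hy)).hasDerivWithinAt)
    (memLp_two_of_continuousOn_Icc' cφ'') f0 f1 f0' f1' hlt
  exact hno h.formDetPSD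

/-- **SHARPNESS: a sorted positive distinct triple with `c₀(b) > 0` that is NOT sign-admissible has an INDEFINITE two-sided
form** (`¬ DictShiftPSD b`): some integer `m` has `σ_b(m) < 0` (`signAdmissible_iff_latticeSymbol_nonneg`), then case (A)
or case (B). [cite: Zhang2022LandauSiegel, §2 Lemma 2.3; Prop 7.1 p.44; §18 (18.1)] -/
theorem not_dictShiftPSD_of_not_signAdmissible (h0 : 0 < b 0) (h01 : b 0 < b 1) (h12 : b 1 < b 2)
    (hc : 0 < (∑ j : Fin 3, shiftW b j).re) (hns : ¬ SignAdmissible b) : ¬ DictShiftPSD b := by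
  classical
  have hσ : ∃ m : ℤ, latticeSymbol b m < 0 := by
    by_contra hall
    push Not at hall
    exact hns ((signAdmissible_iff_latticeSymbol_nonneg b).2 ⟨h0, h01, h12, hall⟩)
  obtain ⟨m, hm⟩ := hσ
  have hm0 : m ≠ 0 := by
    rintro rfl
    simp [latticeSymbol] at hm
  have h02 : b 0 < b 2 := h01.trans h12
  have hb0 : ∀ j, b j ≠ 0 := by
    intro j; fin_cases j
    · exact h0.ne'
    · exact (h0.trans h01).ne'
    · exact (h0.trans h02).ne'
  have hinj : Function.Injective b := by
    intro i j hij
    fin_cases i <;> fin_cases j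
    all_goals first | rfl | (exfalso; simp at hij; linarith)
  by_cases hQ : ClampedBulkNonneg b
  · exact not_dictShiftPSD_of_clampedBulkNonneg h01.ne h02.ne h12.ne hb0 hc hm0 hm hQ
  · exact not_dictShiftPSD_of_not_clampedBulkNonneg hinj hc hQ

/-- **THE EQUIVALENCE.** For a sorted positive distinct shift triple with `c₀(b) > 0`:
`Det.DictShiftPSD b ↔ Det.SignAdmissible b` — Lemma 2.3's box is EXACTLY the set of triples whose (two-sided, windowed)
main-term form «dict_S» is positive semidefinite on `H¹` profiles (⇐: the circle chain `dictShiftPSD_of_signAdmissible`;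
⇒: this file). [cite: Zhang2022LandauSiegel, §2 Lemma 2.3; §4 (4.1); Prop 7.1 p.44 with (7.2); §18 (18.1)] -/
theorem dictShiftPSD_iff_signAdmissible (h0 : 0 < b 0) (h01 : b 0 < b 1) (h12 : b 1 < b 2)
    (hc : 0 < (∑ j : Fin 3, shiftW b j).re) : DictShiftPSD b ↔ SignAdmissible b :=
  ⟨fun h => by_contra fun hns => not_dictShiftPSD_of_not_signAdmissible h0 h01 h12 hc hns h,
    fun hb => dictShiftPSD_of_signAdmissible hb⟩

/-! ### Part 4 (append) — the equivalence under `c₀ ≠ 0` (both signs) -/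

/-- **THE EQUIVALENCE for every sorted positive distinct triple OFF the hypersurface `c₀(b) = 0`:**
`Det.DictShiftPSD b ↔ Det.SignAdmissible b`. For `c₀ > 0` this is `dictShiftPSD_iff_signAdmissible`; for `c₀ < 0` both
sides fail — the one-sided form is already indefinite (`Det.not_formDetPSD_of_re_sum_shiftW_neg`, bump witness) and a
sign-admissible triple has `c₀ > 0` (`Det.re_sum_shiftW_pos`). [cite: Zhang2022LandauSiegel, §2 Lemma 2.3; §4 (4.1); Prop 7.1 p.44 with (7.2); §18 (18.1)] -/
theorem dictShiftPSD_iff_signAdmissible_of_ne (h0 : 0 < b 0) (h01 : b 0 < b 1) (h12 : b 1 < b 2)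
    (hc : (∑ j : Fin 3, shiftW b j).re ≠ 0) : DictShiftPSD b ↔ SignAdmissible b := by
  rcases lt_or_gt_of_ne hc with hneg | hpos
  · have h02 : b 0 < b 2 := h01.trans h12
    have hinj : Function.Injective b := by
      intro i j hij
      fin_cases i <;> fin_cases j
      all_goals first | rfl | (exfalso; simp at hij; linarith)
    have he2 : 0 ≤ b 0 * b 1 + b 1 * b 2 + b 2 * b 0 := by
      have h1 : 0 < b 1 := h0.trans h01
      have h2 : 0 < b 2 := h0.trans h02
      positivity
    constructor
    · intro h
      exact absurd h.formDetPSD (not_formDetPSD_of_re_sum_shiftW_neg hinj he2 hneg)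
    · intro hb
      exact absurd (re_sum_shiftW_pos hb) (not_lt.2 hneg.le)
  · exact dictShiftPSD_iff_signAdmissible h0 h01 h12 hpos

/-! ### Part 5 (append) — inside the box case (B) cannot occur: `SignAdmissible b → ClampedBulkNonneg b` -/

/-- **For a sign-admissible triple the doubly-clamped bulk form of the unit interval is PSD** (so the dichotomy's case (B)
never occurs inside Lemma 2.3's box): extend `φ` by `0` to the period cell and apply the periodic two-piece Parseval
inequality (`Det.bulkFormOn_periodic_two_piece_nonneg_of_signAdmissible`, K3′). [cite: Zhang2022LandauSiegel, §2 Lemma 2.3; Prop 7.1 p.44 with (7.2), (8.11)–(8.23)] -/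
theorem clampedBulkNonneg_of_signAdmissible (hb : SignAdmissible b) : ClampedBulkNonneg b := by
  classical
  intro φ φ' φ'' dφ dφ' cφ'' f0 f1 f0' f1'
  have cφ : ContinuousOn φ (Icc 0 1) := fun t ht =>
    (dφ t (by rwa [uIcc_of_le zero_le_one])).continuousAt.continuousWithinAt
  have cφ' : ContinuousOn φ' (Icc 0 1) := fun t ht =>
    (dφ' t (by rwa [uIcc_of_le zero_le_one])).continuousAt.continuousWithinAt
  have hz : bulkFormOn b (-1) 0 (fun _ => (0:ℂ)) (fun _ => (0:ℂ)) (fun _ => (0:ℂ)) = 0 := by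
    unfold bulkFormOn; simp
  have h := bulkFormOn_periodic_two_piece_nonneg_of_signAdmissible hb ∅
    (L := fun _ => (0:ℂ)) (L' := fun _ => (0:ℂ)) (L'' := fun _ => (0:ℂ)) (R := φ) (R' := φ') (R'' := φ'')
    continuousOn_const continuousOn_const (memLp_two_of_continuousOn_Icc' continuousOn_const)
    (fun y _ => (hasDerivAt_const y (0:ℂ)).hasDerivWithinAt) (fun y _ => (hasDerivAt_const y (0:ℂ)).hasDerivWithinAt)
    cφ cφ' (memLp_two_of_continuousOn_Icc' cφ'')
    (fun y hy => (dφ y (by rw [uIcc_of_le zero_le_one]; exact Ioo_subset_Icc_self hy)).hasDerivWithinAt)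
    (fun y hy _ => (dφ' y (by rw [uIcc_of_le zero_le_one]; exact Ioo_subset_Icc_self hy)).hasDerivWithinAt)
    (by simp [f0]) (by simp [f0']) (by simp [f1]) (by simp [f1'])
  rw [hz, zero_add] at h
  exact h

/-- Hence inside the box the twist-witness hypothesis is automatic, and the dichotomy of
`not_dictShiftPSD_of_not_signAdmissible` is between the box (PSD) and its complement (indefinite).
[cite: Zhang2022LandauSiegel, §2 Lemma 2.3; Prop 7.1 p.44 with (7.2)] -/
theorem clampedBulkNonneg_std : ClampedBulkNonneg ![1, 2, 3] :=
  clampedBulkNonneg_of_signAdmissible signAdmissible_std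

end Det

end Literature.NumberTheory.LFunctions.Zhang2022
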